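/- Copyright: the b2b-balaban cell (near-miss cell 7), T⁴-continuum fan-out, ROUND-2 swarm `t4-ne7b-formalise-*`
(leaf 01), row NE7b (node U5c COUNT member).  Released under the licence of the surrounding project. -/
import Summits.QuantumFields.BalabanUV.T4Continuum.Support.HistoryWindows
import Literature.MathematicalPhysics.QuantumFieldTheory.Balaban1983to89.B16OverhangN

/-!
# THE TOUCH-BIRTH WINDOW: «K ≤ n₀ − j + R_j» for a TOUCH-connected cluster (row NE7b, INTERFACE REQUEST IR-41-3 (ii)
of the row's CRUX prover t4-ne7b-p1 gen 41, `HOME/INBOX.md` block of 2026-08-21T04:38Z; located open point G-M4-1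
«fresh touching clusters» of ruling R-OWNER-41-4)

Summits-side support leaf of the T⁴-continuum cell (rung (B)+1 on a FINITE torus only; NOT infinite volume, NOT the
mass gap, NOT the Clay statement; NOT a proof of the spine estimate NE7b, which is the cell's OWN estimate, NOT PRINTED
and NOT PROVED).  [folklore] finite ℤᵈ ∕ ℝᵈ geometry over the Literature index model (`B13ScaleTransfer`: `Adj`,
`Linked`, `FaceConnected`, `block`, `collar`, `coarse`, `closureIdx`; `TreeLength`: `cube`, `Admissible`, `treeLen`,
`steinerLen`; `B16SProfile`: `Sop`, `Siter`, `ratio`, `DropCtl`; `B16StoppingRule`: `CondI`, `StopAt`;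
`B16MergeGeometry`: `Touch`, `TouchConnected`, `touch_coarse`; `B16OverhangN`: `faceConnected_Sop_of_touchConnected`,
`card_Sop_le`), and row S1b's `HistoryWindows.stopAt_birth` BY NAME; nothing printed is asserted, no `Prop`-valued fact of
Bałaban's, no cite-tagged hypothesis, zero `sorry`.  B16 = [Balaban1989LargeFieldII] pp. 384–385 is a manuscript
UNDER AUDIT and appears only as a LOCATOR (p. 385 «Take a component Z of the region Z₁ … Z ⊂ ⋃_i (Z₁^{(i)})^{~2}»:
a fresh cluster of touching new regions is a TOUCH-connected union of closed cubes, not a face-connected one).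

WHY.  Row S1b's birth window `HistoryWindows.stopAt_birth` asks `FaceConnected Z` (through the coarsening inequality
and the threshold machinery of `B16SProfile`), while print's linear size `d′` (`TreeLength.treeLen`, the shortest
connected graph inside the CLOSED cubes meeting every cube) only needs a connected union of closed cubes, i.e.
touch-connectedness.  THIS FILE: (§1) admissible graphs EXIST for touch-connected families (touching closed cubes
meet; one segment of sup-length `≤ 1` per adjoined cube), so `treeLen` of a touch-connected family is a genuine
infimum and the linear volume bound `card ≤ 2^d(4·treeLen + 1)` holds for it; (§2) ONE `S`-STEP makes a
touch-connected family FACE-connected — IN THE TREE ALREADY (`B16OverhangN.faceConnected_Sop_of_touchConnected`, with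
`touchConnected_closureIdx`, `faceConnected_collar_of_touchConnected`; reused BY NAME, not restated) — and the class
of the first image, `treeLen (S_q(Z)) ≤ 42^d·(4·treeLen Z + 1) − 1` (cube counting: `B16OverhangN.card_Sop_le`
«#S(X) ≤ 21^d·#X» and §1's volume bound; flow-free); (§3) index shifts; (§4) **`stopAt_birth_touch`**: `HistoryWindows.stopAt_birth` applied to the first image
with the shifted flow — the stopping property at `i₀ + N` with `i₀ ≤ fatWaitT d cls := fatWait (42^d(4·cls+1)) + 1`
and condition (i) (with `64`) at every later index; (§5) the booking corollary: a touch-birth booked with class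
`clsT d cls := 4·42^d·(4·cls+1)` fits the dictionary's birth window (`birthTouch_lt_dictW`).  THE TRUE CONSTANT:
one extra step and `log₂` of the first image's cube-count class (`≤ log₂ cls + 5.4·d + 4`) — not the bare
`fatWait cls`.

HONEST.  Proves nothing of Bałaban's; BY-NAME EFFECT ON THE WALL (`WALL-NE7b-P1.md` §2): NONE — a geometric input
requested by the owner for the junction M4 (G-M4-1); NE7b NOT proved; spine 0∕9.  HONEST DEPENDENCY (cell): continuum
YM on T⁴ ⇐ BetaPertH ∧ nine spine estimates (0/9 proved); BetaPertH ⇐ (D1) ∧ (D4) ∧ CAP+tail; G-an2-4 gates asym, D1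
and NE2/3/4.  This file changes none of it. -/

open Finset
open Literature.MathematicalPhysics.QuantumFieldTheory.Balaban1983to89
open Literature.MathematicalPhysics.QuantumFieldTheory.Balaban1983to89.B13ScaleTransfer
open Literature.MathematicalPhysics.QuantumFieldTheory.Balaban1983to89.TreeLength
open Literature.MathematicalPhysics.QuantumFieldTheory.Balaban1983to89.B16SProfile
open Literature.MathematicalPhysics.QuantumFieldTheory.Balaban1983to89.B16StoppingRule
open Literature.MathematicalPhysics.QuantumFieldTheory.Balaban1983to89.B16MergeGeometry
open T4PersistenceDictionary
open Summit.QuantumFields.BalabanUV.T4Continuum.HistoryWindows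
open Literature.MathematicalPhysics.QuantumFieldTheory.Balaban1983to89.B16OverhangN (card_Sop_le)

namespace Summit.QuantumFields.BalabanUV.T4Continuum.HistoryWindowsTouch

noncomputable section

variable {d : ℕ}

/-! ## §1 Admissible graphs for touch-connected families; the linear volume bound -/

/-- **TOUCHING CLOSED CUBES MEET, within sup-distance `1` of any point of the first**: for `Touch a c` and
`p ∈ cube a` there is `q ∈ cube a ∩ cube c` with `dist p q ≤ 1` (project `p` coordinatewise onto `[c_i, c_i + 1]`).
[folklore] -/
theorem exists_touch_point {a c : Pt d} (hac : Touch a c) {p : RPt d} (hp : p ∈ cube a) :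
    ∃ q : RPt d, q ∈ cube a ∧ q ∈ cube c ∧ dist p q ≤ 1 := by
  have hp' := mem_cube.1 hp
  refine ⟨fun i => max (c i : ℝ) (min (p i) ((c i : ℝ) + 1)), ?_, ?_, ?_⟩
  · rw [mem_cube]
    intro i
    obtain ⟨h1, h2⟩ := hp' i
    have hca : (c i : ℝ) ≤ a i + 1 := by exact_mod_cast (hac i).2
    have hac' : (a i : ℝ) ≤ c i + 1 := by exact_mod_cast (hac i).1
    exact ⟨le_max_of_le_right (le_min h1 hac'), max_le hca (min_le_of_left_le h2)⟩
  · rw [mem_cube]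
    intro i
    exact ⟨le_max_left _ _, max_le (by linarith) (min_le_right _ _)⟩
  · rw [dist_pi_le_iff zero_le_one]
    intro i
    rw [Real.dist_eq]
    obtain ⟨h1, h2⟩ := hp' i
    have hca : (c i : ℝ) ≤ a i + 1 := by exact_mod_cast (hac i).2
    have hac' : (a i : ℝ) ≤ c i + 1 := by exact_mod_cast (hac i).1
    have hq1 : (a i : ℝ) ≤ max (c i : ℝ) (min (p i) ((c i : ℝ) + 1)) := le_max_of_le_right (le_min h1 hac')
    have hq2 : max (c i : ℝ) (min (p i) ((c i : ℝ) + 1)) ≤ a i + 1 := max_le hca (min_le_of_left_le h2)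
    exact abs_sub_le_iff.2 ⟨by linarith, by linarith⟩

/-- **ADJOIN STEP THROUGH A TOUCH**: an admissible graph for `A` extends to one for `insert c A`, `c` a cube touching a
cube of `A`, at cost `≤ 1` (one segment inside the cube of `A`, ending on the common point set). [folklore] -/
theorem adjoin_step_touch {A : Finset (Pt d)} {T : List (Seg d)} (hT : Admissible A T) {a c : Pt d} (ha : a ∈ A)
    (hac : Touch a c) : ∃ T', Admissible (insert c A) T' ∧ len T' ≤ len T + 1 := by
  obtain ⟨p, hpT, hpa⟩ := hT.meets a ha
  obtain ⟨q, hqa, hqc, hpq⟩ := exists_touch_point hac hpa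
  refine ⟨(p, q) :: T, ⟨?_, ?_, ?_⟩, ?_⟩
  · rw [carrier_cons]
    exact IsConnected.union ⟨p, left_mem_segment ℝ p q, hpT⟩
      ((convex_segment p q).isConnected ⟨p, left_mem_segment ℝ p q⟩) hT.connected
  · rw [carrier_cons, Set.union_subset_iff]
    exact ⟨((convex_cube a).segment_subset hpa hqa).trans (cube_subset_cubes (Finset.mem_insert_of_mem ha)),
      hT.subset.trans (cubes_mono (Finset.subset_insert c A))⟩
  · intro x hx
    rcases Finset.mem_insert.1 hx with rfl | hx
    · exact ⟨q, Set.mem_union_left _ (right_mem_segment ℝ p q), hqc⟩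
    · obtain ⟨r, hr, hrx⟩ := hT.meets x hx
      exact ⟨r, Set.mem_union_right _ hr, hrx⟩
  · rw [len_cons]
    change dist p q + len T ≤ len T + 1
    linarith

/-- **TOUCH FRONTIER**: if `X ⊆ Y`, `X` is non-empty, `Y` is touch-connected and `Y ⊄ X`, some cube of `Y ∖ X` touches a
cube of `X`. [folklore] -/
theorem exists_touch_frontier {X Y : Finset (Pt d)} (hXY : X ⊆ Y) (hY : TouchConnected Y) {x₀ y : Pt d}
    (hx₀ : x₀ ∈ X) (hy : y ∈ Y) (hyX : y ∉ X) : ∃ a ∈ X, ∃ c ∈ Y, c ∉ X ∧ Touch a c := by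
  have key : ∀ z, Relation.ReflTransGen (TouchStep Y) x₀ z → z ∈ X ∨ ∃ a ∈ X, ∃ c ∈ Y, c ∉ X ∧ Touch a c := by
    intro z hz
    induction hz with
    | refl => exact Or.inl hx₀
    | @tail b c _ hbc ih =>
      rcases ih with hb | hfr
      · obtain ⟨-, hcY, htouch⟩ := hbc
        by_cases hc : c ∈ X
        · exact Or.inl hc
        · exact Or.inr ⟨b, hb, c, hcY, hc, htouch⟩
      · exact Or.inr hfr
  rcases key y (hY x₀ (hXY hx₀) y hy) with h | h
  · exact absurd h hyX
  · exact h

/-- extension along touch frontiers: an admissible graph for `A ⊆ Y`, `Y` touch-connected, extends to one for `Y` at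
cost `≤ |Y ∖ A|` (induction on `|Y ∖ A|`). [folklore] -/
theorem exists_admissible_extend_touch {Y : Finset (Pt d)} (hY : TouchConnected Y) :
    ∀ n : ℕ, ∀ (A : Finset (Pt d)) (T : List (Seg d)), A ⊆ Y → (Y \ A).card = n → Admissible A T →
      ∃ T', Admissible Y T' ∧ len T' ≤ len T + n := by
  intro n
  induction n with
  | zero =>
    intro A T hAY hcard hT
    have hAeq : A = Y :=
      Finset.Subset.antisymm hAY (Finset.sdiff_eq_empty_iff_subset.1 (Finset.card_eq_zero.1 hcard))
    subst hAeq
    exact ⟨T, hT, by simp⟩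
  | succ n ih =>
    intro A T hAY hcard hT
    obtain ⟨x₀, hx₀⟩ := hT.finset_nonempty
    have hne : (Y \ A).Nonempty := by
      rw [← Finset.card_pos, hcard]
      exact Nat.succ_pos n
    obtain ⟨y, hy⟩ := hne
    rw [Finset.mem_sdiff] at hy
    obtain ⟨a, ha, c, hc, hcA, hac⟩ := exists_touch_frontier hAY hY hx₀ hy.1 hy.2
    obtain ⟨T₁, hT₁, hlen₁⟩ := adjoin_step_touch hT ha hac
    have hsub : insert c A ⊆ Y := Finset.insert_subset hc hAY
    have hcard' : (Y \ insert c A).card = n := by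
      rw [Finset.sdiff_insert, Finset.card_erase_of_mem (Finset.mem_sdiff.2 ⟨hc, hcA⟩), hcard]
      simp
    obtain ⟨T', hT', hlen'⟩ := ih (insert c A) T₁ hsub hcard' hT₁
    refine ⟨T', hT', ?_⟩
    push_cast
    linarith

/-- **EVERY NON-EMPTY TOUCH-CONNECTED FAMILY HAS AN ADMISSIBLE GRAPH**, of length `≤ |Y| − 1` — so its `treeLen` is a
genuine infimum (not the junk value of an empty set of lengths). [folklore] -/
theorem exists_admissible_of_touchConnected {Y : Finset (Pt d)} (hY : Y.Nonempty) (hc : TouchConnected Y) :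
    ∃ T, Admissible Y T ∧ len T ≤ (Y.card : ℝ) - 1 := by
  obtain ⟨x, hx⟩ := hY
  have hxY : ({x} : Finset (Pt d)) ⊆ Y := Finset.singleton_subset_iff.2 hx
  obtain ⟨T', hT', hlen⟩ := exists_admissible_extend_touch hc _ {x} _ hxY rfl (admissible_singleton x)
  refine ⟨T', hT', ?_⟩
  have h1 : (Y \ {x}).card + 1 = Y.card := by
    have := Finset.card_sdiff_add_card_eq_card hxY
    simpa using this
  have h2 : ((Y \ {x}).card : ℝ) = Y.card - 1 := by
    have h1' : (((Y \ {x}).card : ℕ) : ℝ) + 1 = (Y.card : ℝ) := by exact_mod_cast h1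
    linarith
  have h3 : len [(corner x, corner x)] = 0 := by simp
  linarith

/-- the Steiner length of a touch-connected family is at most its tree length [folklore] -/
theorem steinerLen_le_treeLen_touch {Y : Finset (Pt d)} (hY : Y.Nonempty) (hc : TouchConnected Y) :
    steinerLen Y ≤ treeLen Y := by
  obtain ⟨T₀, hT₀, -⟩ := exists_admissible_of_touchConnected hY hc
  exact le_treeLen ⟨T₀, hT₀⟩ fun T hT => steinerLen_le_len hT.sAdmissible

/-- **THE LINEAR VOLUME BOUND FOR A TOUCH-CONNECTED FAMILY**: `|Y| ≤ 2^d·(4·treeLen Y + 1)`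
(`TreeLength.card_le_steinerLen` is connectedness-free; §1 supplies `steinerLen ≤ treeLen`). [folklore] -/
theorem card_le_treeLen_touch {Y : Finset (Pt d)} (hY : Y.Nonempty) (hc : TouchConnected Y) :
    (Y.card : ℝ) ≤ 2 ^ d * (4 * treeLen Y + 1) := by
  have h1 := card_le_steinerLen hY
  have h2 := steinerLen_le_treeLen_touch hY hc
  have h2d : (0 : ℝ) ≤ 2 ^ d := by positivity
  nlinarith

/-! ## §2 The class of the first image (the `S`-step itself is `B16OverhangN.faceConnected_Sop_of_touchConnected`) -/

/-- **THE TREE LENGTH OF THE FIRST `S`-IMAGE OF A TOUCH-CONNECTED FAMILY** (any ratio `q ≥ 1`):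
`treeLen (S_q(Z)) ≤ 42^d·(4·treeLen Z + 1) − 1` — tree length ≤ cube count − 1 on the now face-connected image
(`B16OverhangN.faceConnected_Sop_of_touchConnected`), `#S_q(Z) ≤ 21^d·#Z` (`B16OverhangN.card_Sop_le`), and §1's
volume bound `#Z ≤ 2^d(4·treeLen Z + 1)`.  Flow-free. [folklore] -/
theorem treeLen_Sop_le_touch {q : ℕ} (hq : 0 < q) {Z : Finset (Pt d)} (hZ : Z.Nonempty) (hZt : TouchConnected Z) :
    treeLen (Sop q Z) ≤ 42 ^ d * (4 * treeLen Z + 1) - 1 := by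
  have h1 := treeLen_le_card_sub_one (Sop_nonempty q hZ) (B16OverhangN.faceConnected_Sop_of_touchConnected hq hZt)
  have h2 : ((Sop q Z).card : ℝ) ≤ 21 ^ d * (Z.card : ℝ) := by exact_mod_cast B16OverhangN.card_Sop_le q Z
  have h4 := card_le_treeLen_touch hZ hZt
  have h21 : (0 : ℝ) ≤ 21 ^ d := by positivity
  have h42 : (42 : ℝ) ^ d = 21 ^ d * 2 ^ d := by rw [← mul_pow]; norm_num
  rw [h42]
  nlinarith [mul_le_mul_of_nonneg_left h4 h21]

/-! ## §3 Index shifts: the flow, the drop control, the iterates and the stopping property read one step later -/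

/-- the flow read from the next step has the shifted ratios (definitionally) [folklore] -/
theorem ratio_shift (L : ℕ) (σ : ℕ → ℕ) : ratio L (fun i => σ (i + 1)) = fun l => ratio L σ (l + 1) := rfl

/-- drop control passes to the flow read from the next step, on the shortened horizon [folklore] -/
theorem dropCtl_shift_one {σ : ℕ → ℕ} {m : ℕ} (h : DropCtl σ m) : DropCtl (fun i => σ (i + 1)) (m - 1) := by
  intro i k hik hk
  have h' := h (i + 1) (k + 1) (by omega) (by omega)
  have e : k + 1 - (i + 1) = k - i := by omega
  rw [e] at h'
  exact h'

/-- `S^{i+1}(Z) = S^{i}` of the first image along the shifted ratios [folklore] -/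
theorem Siter_succ_shift (q : ℕ → ℕ) : ∀ (i : ℕ) (Z : Finset (Pt d)),
    Siter q (i + 1) Z = Siter (fun l => q (l + 1)) i (Sop (q 0) Z)
  | 0, Z => by simp
  | i + 1, Z => by rw [Siter_succ q (i + 1) Z, Siter_succ_shift q i Z, Siter_succ (fun l => q (l + 1)) i]

/-- **the stopping property read one step later**: a stop of the shifted sequence (domains and cleanliness read from
index `1`) at `k` is a stop of the original sequence at `k + 1`. [folklore] -/
theorem stopAt_succ_of_shift {Nsz N : ℕ} {Clean : ℕ → Prop} {X : ℕ → Finset (Pt d)} {k : ℕ}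
    (h : StopAt Nsz N (fun l => Clean (l + 1)) (fun i => X (i + 1)) k) : StopAt Nsz N Clean X (k + 1) := by
  obtain ⟨hk, hI, hN, hall⟩ := h
  refine ⟨Nat.succ_pos k, hI, by omega, fun l h1 h2 => ?_⟩
  obtain ⟨l', rfl⟩ : ∃ l', l = l' + 1 := ⟨l - 1, by omega⟩
  exact hall l' (by omega) (by omega)

/-! ## §4 The touch-birth window -/

/-- **THE FAT WAITING TIME OF A TOUCH-CONNECTED CLUSTER** of class `cls`: one step (to become face-connected) plus the
fat waiting time of the first image's cube-count class `42^d·(4·cls + 1)`. [folklore] -/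
def fatWaitT (d cls : ℕ) : ℕ := fatWait (42 ^ d * (4 * cls + 1)) + 1

/-- **«K ≤ n₀ − j + R_j» FOR A TOUCH-CONNECTED CLUSTER**: for a non-empty TOUCH-connected family `Z` of class
`cls ≥ treeLen Z` (`L ≥ 4`, drop control on a horizon `m ≥ fatWaitT d cls + N`, size parameter `Nsz ≥ 64`, memory
`N ≥ 1`, the steps after the birth clean), the stopping property holds at `i₀ + N` for a threshold
`i₀ ≤ fatWaitT d cls`, and condition (i) (even with `64`) holds at every later index of the horizon — row S1b's
`stopAt_birth` on the first image `S(Z)` (face-connected, `B16OverhangN`; class §2) along the flow read one step later (§3).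
[folklore] -/
theorem stopAt_birth_touch {Nsz N L : ℕ} {σ : ℕ → ℕ} {m : ℕ} (hNsz : 64 ≤ Nsz) (hN : 1 ≤ N) (hL : 4 ≤ L)
    (hσ : DropCtl σ m) {Z : Finset (Pt d)} (hZ : Z.Nonempty) (hZt : TouchConnected Z) {cls : ℕ}
    (hcls : treeLen Z ≤ cls) (Clean : ℕ → Prop) (hclean : ∀ l, 1 ≤ l → l ≤ m → Clean l)
    (hm : fatWaitT d cls + N ≤ m) :
    ∃ i₀, i₀ ≤ fatWaitT d cls ∧ StopAt Nsz N Clean (fun i => Siter (ratio L σ) i Z) (i₀ + N) ∧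
      ∀ i, i₀ < i → i ≤ m → CondI 64 (Siter (ratio L σ) i Z) := by
  have hL0 : 0 < L := by omega
  -- the first image: face-connected, of class `42^d(4 cls + 1)`
  set Z₁ : Finset (Pt d) := Sop (ratio L σ 0) Z with hZ₁
  have hZ₁ne : Z₁.Nonempty := Sop_nonempty _ hZ
  have hZ₁c : FaceConnected Z₁ := B16OverhangN.faceConnected_Sop_of_touchConnected (ratio_pos hL0 σ 0) hZt
  have hcls₁ : treeLen Z₁ ≤ ((42 ^ d * (4 * cls + 1) : ℕ) : ℝ) := by
    have h := treeLen_Sop_le_touch (ratio_pos hL0 σ 0) hZ hZt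
    have h42 : (0 : ℝ) ≤ 42 ^ d := by positivity
    push_cast
    nlinarith [mul_le_mul_of_nonneg_left hcls h42]
  -- the flow read one step later
  have hσ' : DropCtl (fun i => σ (i + 1)) (m - 1) := dropCtl_shift_one hσ
  have hclean' : ∀ l, 1 ≤ l → l ≤ m - 1 → Clean (l + 1) := fun l h1 h2 => hclean (l + 1) (by omega) (by omega)
  have hm' : fatWait (42 ^ d * (4 * cls + 1)) + N ≤ m - 1 := by unfold fatWaitT at hm; omega
  obtain ⟨i₀, hi₀, hstop, hsmall⟩ :=
    stopAt_birth hNsz hN hL hσ' hZ₁ne hZ₁c hcls₁ (fun l => Clean (l + 1)) hclean' hm'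
  -- translate the iterates of the image back to the iterates of `Z`
  have e : ∀ i, Siter (ratio L (fun i => σ (i + 1))) i Z₁ = Siter (ratio L σ) (i + 1) Z := fun i => by
    rw [ratio_shift, hZ₁, ← Siter_succ_shift]
  refine ⟨i₀ + 1, by unfold fatWaitT; omega, ?_, fun i hi him => ?_⟩
  · rw [show i₀ + 1 + N = i₀ + N + 1 by omega]
    apply stopAt_succ_of_shift
    have hX : (fun i => Siter (ratio L (fun i => σ (i + 1))) i Z₁) = fun i => Siter (ratio L σ) (i + 1) Z :=
      funext e
    rw [hX] at hstop
    exact hstop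
  · obtain ⟨i', rfl⟩ : ∃ i', i = i' + 1 := ⟨i - 1, by omega⟩
    rw [← e]
    exact hsmall i' (by omega) (by omega)

/-! ## §5 Against the booked birth window -/

/-- **THE BOOKING CLASS OF A TOUCH-BIRTH**: `4·42^d·(4·cls + 1)` — two more binary orders than the first image's
class, which pay the one extra step. [folklore] -/
def clsT (d cls : ℕ) : ℕ := 4 * (42 ^ d * (4 * cls + 1))

/-- `fatWaitT d cls ≤ fatWait (clsT d cls)` (`log₂(4y) = log₂ y + 2`). [folklore] -/
theorem fatWaitT_le_fatWait_clsT (d cls : ℕ) : fatWaitT d cls ≤ fatWait (clsT d cls) := by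
  unfold fatWaitT clsT fatWait
  set y : ℕ := 42 ^ d * (4 * cls + 1) with hy
  have hy0 : y ≠ 0 := by positivity
  have h2 : Nat.log 2 (4 * y) = Nat.log 2 y + 2 := by
    rw [show 4 * y = y * 2 * 2 by ring, Nat.log_mul_base (by norm_num) (by positivity),
      Nat.log_mul_base (by norm_num) hy0]
  rw [h2]
  omega

/-- **A TOUCH-BIRTH BOOKED WITH CLASS `clsT d cls` FITS THE DICTIONARY'S BIRTH WINDOW**: its physical readiness index
`i₀ + R_j` (`i₀ ≤ fatWaitT d cls`) lies strictly inside `dictW R n₁ (j, 0, clsT d cls) = fatWait (clsT d cls) + R j + 1`.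
[folklore] -/
theorem birthTouch_lt_dictW (R : ℕ → ℕ) (n₁ j : ℕ) {cls i₀ : ℕ} (hi₀ : i₀ ≤ fatWaitT d cls) :
    i₀ + R j < dictW R n₁ (j, 0, clsT d cls) :=
  birth_lt_dictW R n₁ j (hi₀.trans (fatWaitT_le_fatWait_clsT d cls))

end

end Summit.QuantumFields.BalabanUV.T4Continuum.HistoryWindowsTouch
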